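import Literature.NumberTheory.GaloisRepresentations.ContinuousShapiroLiftFunctor
import Literature.NumberTheory.GaloisRepresentations.ContinuousShapiroLiftPairing
import HarnessLib

/-!
# Route `SignedLowerHalves`, crux L `SmallImageLowerHalfBothSigns` (stmt-BirchSwinnertonDyer-23599), line `rtt_w3` v15 — E2, junction row J2,
# research half «δ₁» (the specialisation long exact sequence), brick (δ-a): THE COSET ALGEBRA OF THE PERMUTATION MODELS
# `Maps(G ⧸ N', X) —Σ→ Maps(G ⧸ N, X)` along a CYCLIC fibre `⟨c⟩`

INPUTS hand `bsd-inputs-honda-p1` g24 under LEAD `cruxlead-stmt-BirchSwinnertonDyer-23599` g11 (v15 SPEC `Lines/rtt_w3-v15-SPEC.md`, stub B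
`stub_charRoadJunction_ns`, row J2: the J2 socket `SmallImageRttCharRoad.junction_coker_of_exact₂` (p786107) wants `(δ₁, hδ₁, hex₁)` for honda g23's
specialisation `s` — `coker(sp¹ : 𝐇¹₂ ⧸ T₂ → 𝐇¹_cyc) ↪ 𝐇²₂[T₂]`). At a finite level `(n, k)` the specialisation sequence is the long exact sequence of the
short exact sequence of FINITE DISCRETE `G_S`-modules `0 → ker Σ → Maps(G_S ⧸ N'ₙ, X_k) —Σ→ Maps(G_S ⧸ Nₙ, X_k) → 0` (`Nₙ ⊵ N'ₙ` the images of
`Gal(K̄/K^{cyc}_n) ⊇ Gal(K̄/K̃_n)`) read through Shapiro's lemma, and `ker Σ = (R_{γ₂} − 1)·Maps(G_S ⧸ N'ₙ, X_k)` because the fibres of `G_S ⧸ N' → G_S ⧸ N`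
are `⟨γ₂⟩`-orbits. THIS FILE is the generic (no number theory) coset algebra of that situation, for a group `G`, a topological `R[G]`-module
`X`, subgroups `N' ≤ N` (`N'` normal) and an element `c ∈ N`, in the tree's permutation-model currency `coindFin` / `coindFinSum` (fibre sum `Σ`) /
`coindFinRes` (pull-back `π*`) / `rTransHom` (right translation `R`) / `coindFinMap`:
* §1 `Σ ∘ R_c = Σ` and `R_c ∘ π* = π*` for `c ∈ N`; `R` commutes with `Σ`, `π*` and coefficient maps; transitivity of `Σ`; `Σ` is onto;
* §2 under «the fibres are `⟨c⟩`-orbits» (`hgen`): `ker (R_c − 1) ≤ range π*` and, for FINITE `X`, `ker Σ ≤ range (R_c − 1)` (counting: both have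
  `#Maps(G⧸N',X) / #Maps(G⧸N,X)` elements);
* §3 the VANISHING OF LONG FIBRE SUMS ON INVARIANTS: for `N'' ≤ N'` normal, `d ∈ N'` whose image in `G ⧸ N''` has order `m` with `m • X = 0`, every
  `R_d`-invariant `φ ∈ Maps(G ⧸ N'', X)` has `Σ_{N''→N'} φ = 0` (the fibres of `G ⧸ N'' → G ⧸ N'` are unions of free `⟨d⟩`-orbits) — the finite-level shadow of
  `(γ₂ − 1)Λ₂ ≅ Λ₂` that produces the wrong-way maps of brick (δ-b).
THEOREMS ONLY (`--supports stmt-BirchSwinnertonDyer-23599` helper); closes nothing; crux L, crux M, E2 and BSD remain OPEN and are proved for NO curve by any of this.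
References: [SerreLocalFields1979] VII §5–§6 (induced modules `A ⊗ ℤ[G/H]`, the `G/H`-action); [NeukirchSchmidtWingberg2008] I §5 Prop. (1.5.3)–(1.5.4), I §6
Prop. (1.6.4)–(1.6.5); [Brown1982] III §6 (6.2), VI §3 (cohomology of finite cyclic groups: `ker N = im (g − 1)` on induced modules).
-/

set_option autoImplicit false
-- the Theorems namespace of this sub repeats the summit name by design (D-0017 nested layout)
set_option linter.dupNamespace false

noncomputable section

open CategoryTheory
open scoped Classical

universe u v

namespace Summit.BirchSwinnertonDyer.BirchSwinnertonDyer.Theorems.SmallImageRttD2J2Delta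

open Literature.NumberTheory.GaloisRepresentations

variable {R : Type u} [CommRing R] [TopologicalSpace R]
variable {G : Type v} [Group G] [TopologicalSpace G] [IsTopologicalGroup G]

/-! ## §1 Right translations versus fibre sums, pull-backs and coefficient maps -/

section Basic

variable (X : TopRep.{v} R G) {N N' : Subgroup G} (h : N' ≤ N)

omit [TopologicalSpace G] [IsTopologicalGroup G] in
/-- `π (y c̄') = (π y) c̄` for the projection `π : G ⧸ N' → G ⧸ N` (`N, N'` normal). [cite: NeukirchSchmidtWingberg2008, I §5] -/
theorem quotientMapOfLE_mul_mk [N.Normal] [N'.Normal] (y : G ⧸ N') (c : G) :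
    Subgroup.quotientMapOfLE h (y * (c : G ⧸ N')) = Subgroup.quotientMapOfLE h y * (c : G ⧸ N) := by
  induction y using QuotientGroup.induction_on with
  | H a => rw [← QuotientGroup.mk_mul, Subgroup.quotientMapOfLE_apply_mk, Subgroup.quotientMapOfLE_apply_mk, QuotientGroup.mk_mul]

omit [TopologicalSpace G] [IsTopologicalGroup G] in
/-- `π (y c̄') = π y` when `c ∈ N`. [cite: NeukirchSchmidtWingberg2008, I §5] -/
theorem quotientMapOfLE_mul_mk_of_mem [N'.Normal] (y : G ⧸ N') {c : G} (hc : c ∈ N) :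
    Subgroup.quotientMapOfLE h (y * (c : G ⧸ N')) = Subgroup.quotientMapOfLE h y := by
  induction y using QuotientGroup.induction_on with
  | H a =>
    rw [← QuotientGroup.mk_mul, Subgroup.quotientMapOfLE_apply_mk, Subgroup.quotientMapOfLE_apply_mk, QuotientGroup.eq]
    simpa using hc

omit [TopologicalSpace G] [IsTopologicalGroup G] in
/-- **`R_c ∘ π* = π*` for `c ∈ N`**: a pulled-back function is invariant under right translation along the fibres.
[cite: SerreLocalFields1979, VII §5] -/
theorem rTransHom_coindFinRes_of_mem [N'.Normal] {c : G} (hc : c ∈ N) (φ : coindFin X N) :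
    (rTransHom X N' (c : G ⧸ N')).hom ((coindFinRes X h).hom φ) = (coindFinRes X h).hom φ := by
  funext y
  rw [rTransHom_apply, coindFinRes_apply, coindFinRes_apply, quotientMapOfLE_mul_mk_of_mem h y hc]

omit [TopologicalSpace G] [IsTopologicalGroup G] in
/-- **`π* ∘ R_c̄ = R_c̄' ∘ π*`** (`N, N'` normal, any `c`). [cite: SerreLocalFields1979, VII §5] -/
theorem coindFinRes_rTransHom [N.Normal] [N'.Normal] (c : G) (φ : coindFin X N) :
    (coindFinRes X h).hom ((rTransHom X N (c : G ⧸ N)).hom φ) = (rTransHom X N' (c : G ⧸ N')).hom ((coindFinRes X h).hom φ) := by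
  funext y
  rw [rTransHom_apply, coindFinRes_apply, coindFinRes_apply, rTransHom_apply, quotientMapOfLE_mul_mk]

variable [Fintype (G ⧸ N')]

omit [TopologicalSpace G] [IsTopologicalGroup G] in
/-- **`Σ ∘ R_c = Σ` for `c ∈ N`**: right translation by `c ∈ N` permutes each fibre of `G ⧸ N' → G ⧸ N`.
[cite: SerreLocalFields1979, VII §5] [cite: NeukirchSchmidtWingberg2008, I §5 Prop. (1.5.3)] -/
theorem coindFinSum_rTransHom_of_mem [N'.Normal] {c : G} (hc : c ∈ N) (ψ : coindFin X N') :
    (coindFinSum X h).hom ((rTransHom X N' (c : G ⧸ N')).hom ψ) = (coindFinSum X h).hom ψ := by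
  funext y
  rw [coindFinSum_apply, coindFinSum_apply]
  simp only [rTransHom_apply]
  rw [← Equiv.sum_comp (Equiv.mulRight (c : G ⧸ N'))
    (fun z => if Subgroup.quotientMapOfLE h z = y then ψ z else 0)]
  refine Finset.sum_congr rfl fun z _ => ?_
  simp only [Equiv.coe_mulRight, quotientMapOfLE_mul_mk_of_mem h z hc]

omit [TopologicalSpace G] [IsTopologicalGroup G] in
/-- **`Σ ∘ R_c̄' = R_c̄ ∘ Σ`** (`N, N'` normal, any `c`). [cite: SerreLocalFields1979, VII §5] [cite: NeukirchSchmidtWingberg2008, I §5 Prop. (1.5.3)] -/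
theorem coindFinSum_rTransHom [N.Normal] [N'.Normal] (c : G) (ψ : coindFin X N') :
    (coindFinSum X h).hom ((rTransHom X N' (c : G ⧸ N')).hom ψ) = (rTransHom X N (c : G ⧸ N)).hom ((coindFinSum X h).hom ψ) := by
  funext y
  rw [rTransHom_apply, coindFinSum_apply, coindFinSum_apply]
  simp only [rTransHom_apply]
  rw [← Equiv.sum_comp (Equiv.mulRight (c : G ⧸ N'))
    (fun z => if Subgroup.quotientMapOfLE h z = y * (c : G ⧸ N) then ψ z else 0)]
  refine Finset.sum_congr rfl fun z _ => ?_
  simp only [Equiv.coe_mulRight, quotientMapOfLE_mul_mk, mul_left_inj]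

omit [TopologicalSpace G] [IsTopologicalGroup G] in
/-- **`Σ ∘ (R_c − 1) = 0` for `c ∈ N`.** [cite: SerreLocalFields1979, VII §5] -/
theorem coindFinSum_rTransHom_sub_of_mem [N'.Normal] {c : G} (hc : c ∈ N) (ψ : coindFin X N') :
    (coindFinSum X h).hom ((rTransHom X N' (c : G ⧸ N')).hom ψ - ψ) = 0 := by
  rw [map_sub, coindFinSum_rTransHom_of_mem X h hc, sub_self]

omit [TopologicalSpace G] [IsTopologicalGroup G] in
/-- **The fibre sum is onto**: `Σ ψ = f` for `ψ` supported on a section of `π`. [cite: NeukirchSchmidtWingberg2008, I §5] -/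
theorem coindFinSum_surjective : Function.Surjective (coindFinSum X h).hom := by
  classical
  intro f
  have hπ : Function.Surjective (Subgroup.quotientMapOfLE h : G ⧸ N' → G ⧸ N) := fun y => by
    induction y using QuotientGroup.induction_on with
    | H a => exact ⟨(a : G ⧸ N'), rfl⟩
  let s : G ⧸ N → G ⧸ N' := Function.surjInv hπ
  have hs : ∀ y, Subgroup.quotientMapOfLE h (s y) = y := Function.surjInv_eq hπ
  refine ⟨fun z => if z = s (Subgroup.quotientMapOfLE h z) then f (Subgroup.quotientMapOfLE h z) else 0, funext fun y => ?_⟩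
  rw [coindFinSum_apply, Finset.sum_eq_single (s y)]
  · rw [if_pos (hs y), hs y, if_pos rfl]
  · intro z _ hz
    by_cases hzy : Subgroup.quotientMapOfLE h z = y
    · rw [if_pos hzy, hzy, if_neg hz]
    · rw [if_neg hzy]
  · exact fun hmem => (hmem (Finset.mem_univ _)).elim

omit [TopologicalSpace G] [IsTopologicalGroup G] in
/-- **Transitivity of the fibre sums**: `Σ_{N'→N} ∘ Σ_{N''→N'} = Σ_{N''→N}`. [cite: NeukirchSchmidtWingberg2008, I §5 Prop. (1.5.3)] -/
theorem coindFinSum_coindFinSum {N'' : Subgroup G} (h' : N'' ≤ N') [Fintype (G ⧸ N'')] (ψ : coindFin X N'') :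
    (coindFinSum X h).hom ((coindFinSum X h').hom ψ) = (coindFinSum X (h'.trans h)).hom ψ := by
  funext y
  rw [coindFinSum_apply, coindFinSum_apply]
  simp only [coindFinSum_apply]
  have hcomp : ∀ w : G ⧸ N'', Subgroup.quotientMapOfLE (h'.trans h) w = Subgroup.quotientMapOfLE h (Subgroup.quotientMapOfLE h' w) := fun w => by
    induction w using QuotientGroup.induction_on with
    | H a => rfl
  have hpush : ∀ x : G ⧸ N', (if Subgroup.quotientMapOfLE h x = y then ∑ z : G ⧸ N'', (if Subgroup.quotientMapOfLE h' z = x then ψ z else 0) else 0) =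
      ∑ z : G ⧸ N'', if Subgroup.quotientMapOfLE h x = y then (if Subgroup.quotientMapOfLE h' z = x then ψ z else 0) else 0 := fun x => by
    split_ifs
    · rfl
    · rw [Finset.sum_const_zero]
  rw [Finset.sum_congr rfl fun x _ => hpush x, Finset.sum_comm]
  refine Finset.sum_congr rfl fun z _ => ?_
  rw [Finset.sum_eq_single (Subgroup.quotientMapOfLE h' z)]
  · rw [hcomp]
    by_cases hz : Subgroup.quotientMapOfLE h (Subgroup.quotientMapOfLE h' z) = y
    · rw [if_pos hz, if_pos hz, if_pos rfl]
    · rw [if_neg hz, if_neg hz]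
  · intro x _ hx
    by_cases hxy : Subgroup.quotientMapOfLE h x = y
    · rw [if_pos hxy, if_neg (Ne.symm hx)]
    · rw [if_neg hxy]
  · exact fun hmem => (hmem (Finset.mem_univ _)).elim

end Basic

/-! ## §2 Cyclic fibres: `ker (R_c − 1) = range π*` and `ker Σ = range (R_c − 1)` -/

section Cyclic

variable (X : TopRep.{v} R G) {N N' : Subgroup G} (h : N' ≤ N) [N'.Normal] {c : G}

omit [TopologicalSpace G] [IsTopologicalGroup G] in
/-- An `R_c`-invariant function is invariant under all powers `R_c^j`. [cite: SerreLocalFields1979, VII §5] -/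
theorem apply_mul_pow_eq_of_rTransHom_eq (φ : coindFin X N') (hφ : (rTransHom X N' (c : G ⧸ N')).hom φ = φ) (y : G ⧸ N') (j : ℕ) :
    φ (y * (c : G ⧸ N') ^ j) = φ y := by
  induction j with
  | zero => rw [pow_zero, mul_one]
  | succ j ih =>
    have hy := congrFun hφ (y * (c : G ⧸ N') ^ j)
    rw [rTransHom_apply] at hy
    rw [pow_succ, ← mul_assoc, hy, ih]

omit [TopologicalSpace G] [IsTopologicalGroup G] in
/-- **`ker (R_c − 1) ≤ range π*`** when the fibres are `⟨c̄⟩`-orbits: an `R_c`-invariant function is constant on the fibres, hence pulled back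
from `G ⧸ N`. [cite: SerreLocalFields1979, VII §5] [cite: NeukirchSchmidtWingberg2008, I §6 Prop. (1.6.4)] -/
theorem exists_coindFinRes_eq_of_rTransHom_eq (hgen : ∀ y y' : G ⧸ N', Subgroup.quotientMapOfLE h y = Subgroup.quotientMapOfLE h y' → ∃ j : ℕ, y' = y * (c : G ⧸ N') ^ j) (φ : coindFin X N')
    (hφ : (rTransHom X N' (c : G ⧸ N')).hom φ = φ) : ∃ f : coindFin X N, (coindFinRes X h).hom f = φ := by
  have hπ : Function.Surjective (Subgroup.quotientMapOfLE h : G ⧸ N' → G ⧸ N) := fun y => by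
    induction y using QuotientGroup.induction_on with
    | H a => exact ⟨(a : G ⧸ N'), rfl⟩
  refine ⟨fun x => φ (Function.surjInv hπ x), funext fun y => ?_⟩
  rw [coindFinRes_apply]
  obtain ⟨j, hj⟩ := hgen (Function.surjInv hπ (Subgroup.quotientMapOfLE h y)) y (Function.surjInv_eq hπ _)
  conv_rhs => rw [hj]
  exact (apply_mul_pow_eq_of_rTransHom_eq X φ hφ _ j).symm

omit [TopologicalSpace G] [IsTopologicalGroup G] in
/-- **`ker Σ ≤ range (R_c − 1)`** for FINITE coefficients when `c ∈ N` and the fibres are `⟨c̄⟩`-orbits — the vanishing `Ĥ⁻¹(⟨c̄⟩, Ind) = 0` read by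
counting: `range (R_c − 1) ≤ ker Σ` (§1), and both have `#Maps(G ⧸ N', X) / #Maps(G ⧸ N, X)` elements (`ker (R_c − 1) = range π*`, `π*` into, `Σ` onto).
[cite: Brown1982, VI §3 (cyclic groups), III §6 (6.2)] [cite: SerreLocalFields1979, VII §5–§6] -/
theorem exists_rTransHom_sub_eq_of_coindFinSum_eq_zero [Fintype (G ⧸ N')] [Finite X] (hc : c ∈ N) (hgen : ∀ y y' : G ⧸ N', Subgroup.quotientMapOfLE h y = Subgroup.quotientMapOfLE h y' → ∃ j : ℕ, y' = y * (c : G ⧸ N') ^ j)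
    (ψ : coindFin X N') (hψ : (coindFinSum X h).hom ψ = 0) :
    ∃ φ : coindFin X N', (rTransHom X N' (c : G ⧸ N')).hom φ - φ = ψ := by
  -- the three additive maps
  let T : coindFin X N' →+ coindFin X N' := (rTransHom X N' (c : G ⧸ N')).hom.toLinearMap.toAddMonoidHom - AddMonoidHom.id _
  let Sg : coindFin X N' →+ coindFin X N := (coindFinSum X h).hom.toLinearMap.toAddMonoidHom
  let Pb : coindFin X N →+ coindFin X N' := (coindFinRes X h).hom.toLinearMap.toAddMonoidHom
  have hT : ∀ φ, T φ = (rTransHom X N' (c : G ⧸ N')).hom φ - φ := fun φ => rfl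
  have hSg : ∀ φ, Sg φ = (coindFinSum X h).hom φ := fun φ => rfl
  have hPb : ∀ f, Pb f = (coindFinRes X h).hom f := fun f => rfl
  -- finiteness
  haveI : Finite (G ⧸ N') := Finite.of_fintype _
  have hπ : Function.Surjective (Subgroup.quotientMapOfLE h : G ⧸ N' → G ⧸ N) := fun y => by
    induction y using QuotientGroup.induction_on with
    | H a => exact ⟨(a : G ⧸ N'), rfl⟩
  haveI : Finite (G ⧸ N) := Finite.of_surjective _ hπ
  haveI hfin' : Finite (coindFin X N') := Pi.finite
  haveI hfin : Finite (coindFin X N) := Pi.finite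
  -- (1) `range T ≤ ker Σ`
  have h1 : T.range ≤ Sg.ker := by
    rintro _ ⟨φ, rfl⟩
    rw [AddMonoidHom.mem_ker, hSg, hT]
    exact coindFinSum_rTransHom_sub_of_mem X h hc φ
  -- (2) `ker T = range π*` and `π*` is injective
  have h2 : T.ker = Pb.range := by
    refine le_antisymm (fun φ hφ => ?_) ?_
    · rw [AddMonoidHom.mem_ker, hT, sub_eq_zero] at hφ
      obtain ⟨f, hf⟩ := exists_coindFinRes_eq_of_rTransHom_eq X h hgen φ hφ
      exact ⟨f, hf⟩
    · rintro _ ⟨f, rfl⟩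
      rw [AddMonoidHom.mem_ker, hT, hPb, sub_eq_zero]
      exact rTransHom_coindFinRes_of_mem X h hc f
  have hPbinj : Function.Injective Pb := fun f f' hff' => funext fun x => by
    obtain ⟨y, rfl⟩ := hπ x
    have := congrFun hff' y
    rwa [hPb, hPb, coindFinRes_apply, coindFinRes_apply] at this
  -- (3) `Σ` is onto
  have h3 : Sg.range = ⊤ := AddMonoidHom.range_eq_top.mpr (coindFinSum_surjective X h)
  -- counting
  have cT : Nat.card (coindFin X N') = Nat.card T.range * Nat.card (coindFin X N) := by
    rw [AddSubgroup.card_eq_card_quotient_mul_card_addSubgroup T.ker, Nat.card_congr (QuotientAddGroup.quotientKerEquivRange T).toEquiv,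
      h2, Nat.card_congr (AddMonoidHom.ofInjective hPbinj).toEquiv.symm]
  have cS : Nat.card (coindFin X N') = Nat.card Sg.ker * Nat.card (coindFin X N) := by
    rw [AddSubgroup.card_eq_card_quotient_mul_card_addSubgroup Sg.ker, Nat.card_congr (QuotientAddGroup.quotientKerEquivRange Sg).toEquiv,
      h3, AddSubgroup.card_top, mul_comm]
  have hpos : 0 < Nat.card (coindFin X N) := Nat.card_pos
  have hcard : Nat.card T.range = Nat.card Sg.ker := Nat.eq_of_mul_eq_mul_right hpos (cT.symm.trans cS)
  have heq : T.range = Sg.ker := AddSubgroup.eq_of_le_of_card_ge h1 hcard.ge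
  -- conclude
  have hmem : ψ ∈ Sg.ker := by rw [AddMonoidHom.mem_ker, hSg, hψ]
  rw [← heq] at hmem
  obtain ⟨φ, hφ⟩ := hmem
  exact ⟨φ, hφ⟩

end Cyclic

/-! ## §3 `Σ ∘ π* = [N : N']`, and the vanishing of long fibre sums on pulled-back functions -/

section Index

variable (X : TopRep.{v} R G) {N N' : Subgroup G} (h : N' ≤ N)

omit [TopologicalSpace G] [IsTopologicalGroup G] in
/-- The first component of Mathlib's `Subgroup.quotientEquivProdOfLE` is the projection `π : G ⧸ N' → G ⧸ N`. [folklore] -/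
theorem quotientEquivProdOfLE_fst (z : G ⧸ N') : (Subgroup.quotientEquivProdOfLE h z).1 = Subgroup.quotientMapOfLE h z := by
  induction z using QuotientGroup.induction_on with
  | H a => rfl

omit [TopologicalSpace G] [IsTopologicalGroup G] in
/-- **Every fibre of `π : G ⧸ N' → G ⧸ N` has `[N : N']` elements.** [cite: NeukirchSchmidtWingberg2008, I §5] -/
theorem card_filter_quotientMapOfLE_eq [Fintype (G ⧸ N')] (y : G ⧸ N) :
    (Finset.univ.filter fun z : G ⧸ N' => Subgroup.quotientMapOfLE h z = y).card = (N'.subgroupOf N).index := by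
  rw [Subgroup.index, ← Fintype.card_subtype, ← Nat.card_eq_fintype_card]
  refine Nat.card_congr ?_
  refine ((Subgroup.quotientEquivProdOfLE h).subtypeEquiv (p := fun z => Subgroup.quotientMapOfLE h z = y)
    (q := fun q => q.1 = y) fun z => by rw [quotientEquivProdOfLE_fst]).trans ?_
  exact
    { toFun := fun q => q.1.2
      invFun := fun w => ⟨(y, w), rfl⟩
      left_inv := fun q => by
        obtain ⟨⟨y', w⟩, hy'⟩ := q
        subst hy'
        rfl
      right_inv := fun w => rfl }

omit [TopologicalSpace G] [IsTopologicalGroup G] in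
/-- **`Σ_{N'→N} (π* f) = [N : N'] • f`**: the fibre sum of a pulled-back function counts the fibre. [cite: NeukirchSchmidtWingberg2008, I §5 Cor. (1.5.7)]
[cite: SerreLocalFields1979, VII §7 (Res–Cor)] -/
theorem coindFinSum_coindFinRes [Fintype (G ⧸ N')] (f : coindFin X N) :
    (coindFinSum X h).hom ((coindFinRes X h).hom f) = (N'.subgroupOf N).index • f := by
  funext y
  rw [coindFinSum_apply]
  simp only [coindFinRes_apply]
  have hre : ∀ z : G ⧸ N', (if Subgroup.quotientMapOfLE h z = y then f (Subgroup.quotientMapOfLE h z) else 0) =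
      if Subgroup.quotientMapOfLE h z = y then f y else 0 := fun z => by
    split_ifs with hz
    · rw [hz]
    · rfl
  rw [Finset.sum_congr rfl fun z _ => hre z, ← Finset.sum_filter, Finset.sum_const, card_filter_quotientMapOfLE_eq h y]
  rfl

omit [TopologicalSpace G] [IsTopologicalGroup G] in
/-- **VANISHING OF LONG FIBRE SUMS ON PULLED-BACK FUNCTIONS.** For subgroups `N'' ≤ W`, `W ≤ N` and `W ≤ U` with `[W : N''] • X = 0`, every function pulled
back from `G ⧸ U` to `G ⧸ N''` has fibre sum ZERO down to `G ⧸ N`: `Σ_{N''→N} (π*_{U→N''} f) = Σ_{W→N} ([W : N''] • π*_{U→W} f) = 0`. In the `ℤ_p²`-tower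
(`N = Gal(K̄/K̃_n)`, `N'' = Gal(K̄/K̃_{n+k})`, `U = Gal(K̄/K^{(1)}_{n+k})`, `W = N ⊓ U`, `[W : N''] = p^k`, `X = X_k` killed by `p^k`) this is the vanishing that
makes the wrong-way maps of brick (δ-b) well defined — the finite-level shadow of `(γ₂ − 1)Λ₂ ≅ Λ₂`. [cite: NeukirchSchmidtWingberg2008, I §5 Cor. (1.5.7)]
[cite: SerreLocalFields1979, VII §7] -/
theorem coindFinSum_coindFinRes_eq_zero_of_index_smul_eq_zero {N'' W U : Subgroup G} (hN''W : N'' ≤ W) (hWN : W ≤ N) (hWU : W ≤ U)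
    [Fintype (G ⧸ N'')] [Fintype (G ⧸ W)] (hX : ∀ x : X, (N''.subgroupOf W).index • x = 0) (f : coindFin X U) :
    (coindFinSum X (hN''W.trans hWN)).hom ((coindFinRes X (hN''W.trans hWU)).hom f) = 0 := by
  have hres : (coindFinRes X (hN''W.trans hWU)).hom f = (coindFinRes X hN''W).hom ((coindFinRes X hWU).hom f) := by
    funext z
    rw [coindFinRes_apply, coindFinRes_apply, coindFinRes_apply]
    induction z using QuotientGroup.induction_on with
    | H a => rfl
  rw [hres, ← coindFinSum_coindFinSum X hWN hN''W, coindFinSum_coindFinRes X hN''W]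
  have h0 : (N''.subgroupOf W).index • (coindFinRes X hWU).hom f = 0 := funext fun z => hX _
  rw [h0, map_zero]

end Index

section Coeff

variable {X Y : TopRep.{v} R G} (f : X ⟶ Y) {N N' : Subgroup G} (h : N' ≤ N)

omit [TopologicalSpace G] [IsTopologicalGroup G] in
/-- Coefficient maps commute with right translations. [cite: SerreLocalFields1979, VII §6] -/
theorem coindFinMap_rTransHom [N.Normal] (c : G ⧸ N) (φ : coindFin X N) :
    (coindFinMap f N).hom ((rTransHom X N c).hom φ) = (rTransHom Y N c).hom ((coindFinMap f N).hom φ) := rfl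

omit [TopologicalSpace G] [IsTopologicalGroup G] in
/-- Coefficient maps commute with pull-backs. [cite: SerreLocalFields1979, VII §6] -/
theorem coindFinMap_coindFinRes (φ : coindFin X N) :
    (coindFinMap f N').hom ((coindFinRes X h).hom φ) = (coindFinRes Y h).hom ((coindFinMap f N).hom φ) := rfl

omit [TopologicalSpace G] [IsTopologicalGroup G] in
/-- Coefficient maps commute with fibre sums. [cite: SerreLocalFields1979, VII §6] -/
theorem coindFinMap_coindFinSum [Fintype (G ⧸ N')] (ψ : coindFin X N') :
    (coindFinMap f N).hom ((coindFinSum X h).hom ψ) = (coindFinSum Y h).hom ((coindFinMap f N').hom ψ) := by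
  funext y
  rw [coindFinMap_apply, coindFinSum_apply, coindFinSum_apply, map_sum]
  refine Finset.sum_congr rfl fun z _ => ?_
  split_ifs <;> simp [coindFinMap_apply]

end Coeff

end Summit.BirchSwinnertonDyer.BirchSwinnertonDyer.Theorems.SmallImageRttD2J2Delta

end
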